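import Literature.NumberTheory.ComplexMultiplication.EllipticUnits.ImaginaryQuadraticMainConjectureCarriersO
import Literature.NumberTheory.GaloisRepresentations.LocalKummerTorsion
import Mathlib.RingTheory.Trace.Basic
import Mathlib.NumberTheory.Padics.RingHoms
import HarnessLib

/-!
# Route `SignedLowerHalves`, crux L `SmallImageLowerHalfBothSigns` (stmt-BirchSwinnertonDyer-23599), line `rtt_w3` v14 → v15 — E2, row J3 (Galois side, part β₃d, stage 1):
# THE TRACE COEFFICIENT PAIRING `𝒪 ⊗ μ_{p^k} × 𝒪 → μ_{p^k}`, `(a ⊗ ζ, x) ↦ Tr_{𝒪/ℤ_p}(a x) · ζ` — in coordinates (no Galois module yet), with its three laws: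
# `𝒪`-balance, `p^k 𝒪` in the right kernel, level compatibility (`red = id ⊗ (ζ ↦ ζ^p)` on the left ↔ `x ↦ p x` and `μ_{p^k} ⊆ μ_{p^{k+1}}`), and the character twist law

WIDTH seat `bsd-line-slh-p3-w3` g22 under LEAD `cruxlead-stmt-BirchSwinnertonDyer-23599` g11 (cell `bsd-ssimc`); helper `--supports stmt-BirchSwinnertonDyer-23599`.
DEFINITIONS WITH BODIES + THEOREMS; no named fact, no instance, no `sorry`. HONEST FRAMING: stage 1 of the remaining input (β₃d) "coefficient pairings `Pk`" of
`exists_junction_exact_of_inputs` (p790304) for the LEAD's `M = Cofree θ F` (rank one, `M[p^k] ≅ 𝒪/p^k`): the pairing on COORDINATES `x ∈ 𝒪`; stage 2 (the coordinate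
`M[p^k] ≅ 𝒪/p^k` of `Cofree θ F`) and stage 3 (Galois equivariance `θ′θ = 1`, packaging as `ContPairing`, the binders `hPred`/`hPsc`) are the sequel. E2, crux L/M, BSD remain OPEN.

* §1 (`n • ζ = 0` is the tree's `PoitouTateReduction.mu_nsmul_eq_zero_level`, inlined) `zmodSMulMu n ζ : ℤ/n →+ μ_n` (`t ↦ t·ζ`, `ZMod.lift`), `traceZMod S k : 𝒪 →+ ℤ/p^k` (`Tr_{𝒪/ℤ_p}` then `toZModPow`).
* §2 ★ `tracePairing S K k : OMuCarrier K S (p^k) →+ (𝒪 →+ μ_{p^k})`, `tracePairing_tmul`; ★ `tracePairing_oMuScalar` (balance `((c ⊗ id) w, x) = (w, c x)`),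
  ★ `tracePairing_mul_pow_eq_zero` (`(w, p^k y) = 0`), ★ `muInclusion_tracePairing_oMuRed` (level law `ι((red w, y)_k) = (w, p y)_{k+1}`), ★ `tracePairing_muTwistO` (twist law:
  `(σ·w, t x) = σ·(w, x)` whenever `θ′(σ) t = 1` — the Galois equivariance against `(F/𝒪)(θ)` once `t = θ(σ)`).
References: [NeukirchSchmidtWingberg2008] (7.2.6); [Rubin2000] §4.2 (the pairing `T*/p^k × W[p^k] → μ_{p^k}`); [JohnsonLeungKings2011] Def. 4.2.
-/

set_option autoImplicit false
set_option linter.dupNamespace false -- D-0017: single-problem summit, the namespace repeats the problem name by design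
noncomputable section

open scoped Classical TensorProduct
open NumberField IsDedekindDomain Field

namespace Summit.BirchSwinnertonDyer.BirchSwinnertonDyer.Theorems.SmallImageRttD2Seq

open Literature.NumberTheory.EllipticCurves Literature.NumberTheory.GaloisRepresentations Literature.NumberTheory.GaloisRepresentations.DiscreteGaloisModule
  Literature.NumberTheory.ComplexMultiplication.EllipticUnits.JohnsonLeungKings2011

/-! ## §1. `ℤ/n` acting on `μ_n`, and the trace mod `p^k` -/

section ZMod

variable (K : Type) [Field K] (n : ℕ)


/-- **`t ↦ t·ζ : ℤ/n → μ_n`** (`ZMod.lift` of `z ↦ z • ζ`). [folklore] -/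
def zmodSMulMu (ζ : MuCarrier K n) : ZMod n →+ MuCarrier K n :=
  ZMod.lift n ⟨zmultiplesHom (MuCarrier K n) ζ, by
    change (n : ℤ) • ζ = 0
    rw [natCast_zsmul]
    exact muVal_injective K n (by rw [muVal_nsmul, muVal_pow_eq_one, muVal_zero])⟩

/-- `zmodSMulMu ζ z = z • ζ` for `z ∈ ℤ`. [folklore] -/
theorem zmodSMulMu_intCast (ζ : MuCarrier K n) (z : ℤ) : zmodSMulMu K n ζ (z : ZMod n) = z • ζ := by
  rw [zmodSMulMu, ZMod.lift_coe]; rfl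

/-- `zmodSMulMu` is additive in `ζ`. [folklore] -/
theorem zmodSMulMu_add (ζ ζ' : MuCarrier K n) (t : ZMod n) : zmodSMulMu K n (ζ + ζ') t = zmodSMulMu K n ζ t + zmodSMulMu K n ζ' t := by
  obtain ⟨z, rfl⟩ := ZMod.intCast_surjective t
  rw [zmodSMulMu_intCast, zmodSMulMu_intCast, zmodSMulMu_intCast, zsmul_add]

/-- `zmodSMulMu 0 = 0`. [folklore] -/
theorem zmodSMulMu_zero (t : ZMod n) : zmodSMulMu K n 0 t = 0 := by
  obtain ⟨z, rfl⟩ := ZMod.intCast_surjective t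
  rw [zmodSMulMu_intCast, zsmul_zero]

/-- An additive map out of `μ_n` commutes with `zmodSMulMu`. [folklore] -/
theorem map_zmodSMulMu {m : ℕ} (f : MuCarrier K n →+ MuCarrier K m) (ζ : MuCarrier K n) (z : ℤ) :
    f (zmodSMulMu K n ζ (z : ZMod n)) = z • f ζ := by
  rw [zmodSMulMu_intCast, map_zsmul]

end ZMod

section Trace

variable {p : ℕ} [Fact p.Prime] (S : Set (PadicAlgCl p))

/-- **`Tr_{𝒪/ℤ_p} mod p^k : 𝒪 →+ ℤ/p^k`.** [cite: NeukirchSchmidtWingberg2008, (7.2.6)] -/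
def traceZMod (k : ℕ) : padicCoeffIntegers S →+ ZMod (p ^ k) :=
  letI : Algebra ℤ_[p] (padicCoeffIntegers S) := (padicIntToCoeffIntegers S).toAlgebra
  (PadicInt.toZModPow k).toAddMonoidHom.comp (Algebra.trace ℤ_[p] (padicCoeffIntegers S)).toAddMonoidHom

/-- Unfolding `traceZMod` (the `ℤ_p`-algebra structure of `𝒪` is `padicIntToCoeffIntegers`, as everywhere in the tree). [folklore] -/
theorem traceZMod_apply (k : ℕ) (x : padicCoeffIntegers S) :
    traceZMod S k x = (letI : Algebra ℤ_[p] (padicCoeffIntegers S) := (padicIntToCoeffIntegers S).toAlgebra; PadicInt.toZModPow k (Algebra.trace ℤ_[p] (padicCoeffIntegers S) x)) :=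
  rfl

/-- `traceZMod` is `ℤ_p`-semilinear: `Tr(c y) mod p^k = (c mod p^k) · (Tr y mod p^k)` for `c ∈ ℤ_p`. [folklore] -/
theorem traceZMod_padicInt_mul (k : ℕ) (c : ℤ_[p]) (y : padicCoeffIntegers S) :
    traceZMod S k (padicIntToCoeffIntegers S c * y) = PadicInt.toZModPow k c * traceZMod S k y := by
  letI : Algebra ℤ_[p] (padicCoeffIntegers S) := (padicIntToCoeffIntegers S).toAlgebra
  rw [traceZMod_apply, traceZMod_apply, show padicIntToCoeffIntegers S c * y = c • y from (Algebra.smul_def c y).symm, map_smul, smul_eq_mul, map_mul]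

/-- `Tr(p^k y) ≡ 0 (mod p^k)`. [folklore] -/
theorem traceZMod_natCast_pow_mul (k : ℕ) (y : padicCoeffIntegers S) : traceZMod S k (((p : ℕ) : padicCoeffIntegers S) ^ k * y) = 0 := by
  rw [show ((p : ℕ) : padicCoeffIntegers S) ^ k = padicIntToCoeffIntegers S ((p : ℤ_[p]) ^ k) by rw [map_pow, map_natCast], traceZMod_padicInt_mul,
    map_pow, map_natCast, ← Nat.cast_pow, ZMod.natCast_self, zero_mul]

/-- Level change of the trace: `Tr_{k+1}(p y)` is `p · Tr_{k+1}(y)` and reduces to `Tr_k(y)`. [folklore] -/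
theorem traceZMod_succ_cast (k : ℕ) (y : padicCoeffIntegers S) : (ZMod.castHom (pow_dvd_pow p (Nat.le_succ k)) (ZMod (p ^ k)) (traceZMod S (k + 1) y)) = traceZMod S k y := by
  rw [traceZMod_apply, traceZMod_apply, ZMod.castHom_apply, PadicInt.cast_toZModPow k (k + 1) (Nat.le_succ k)]

end Trace

/-! ## §2. The trace pairing `𝒪 ⊗ μ_{p^k} × 𝒪 → μ_{p^k}` -/

section Pairing

variable {p : ℕ} [Fact p.Prime] (S : Set (PadicAlgCl p)) (K : Type) [Field K]

/-- The pairing on pure tensors: `a ↦ ζ ↦ (x ↦ Tr(a x)·ζ)`. [cite: Rubin2000, §4.2] -/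
def tracePairingAux (k : ℕ) : padicCoeffIntegers S →+ MuCarrier K (p ^ k) →+ (padicCoeffIntegers S →+ MuCarrier K (p ^ k)) :=
  haveI : NeZero (p ^ k) := ⟨pow_ne_zero _ (Fact.out : p.Prime).ne_zero⟩
  { toFun := fun a ↦
      { toFun := fun ζ ↦ (zmodSMulMu K (p ^ k) ζ).comp ((traceZMod S k).comp (AddMonoidHom.mulLeft a))
        map_zero' := by ext x; exact zmodSMulMu_zero K (p ^ k) _
        map_add' := fun ζ ζ' ↦ by ext x; exact zmodSMulMu_add K (p ^ k) ζ ζ' _ }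
    map_zero' := by
      ext ζ x
      change zmodSMulMu K (p ^ k) ζ (traceZMod S k (0 * x)) = 0
      rw [zero_mul, map_zero, map_zero]
    map_add' := fun a b ↦ by
      ext ζ x
      change zmodSMulMu K (p ^ k) ζ (traceZMod S k ((a + b) * x)) = zmodSMulMu K (p ^ k) ζ (traceZMod S k (a * x)) + zmodSMulMu K (p ^ k) ζ (traceZMod S k (b * x))
      rw [add_mul, map_add, map_add] }

/-- Unfolding `tracePairingAux`. [folklore] -/
theorem tracePairingAux_apply (k : ℕ) (a : padicCoeffIntegers S) (ζ : MuCarrier K (p ^ k)) (x : padicCoeffIntegers S) :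
    tracePairingAux S K k a ζ x = (haveI : NeZero (p ^ k) := ⟨pow_ne_zero _ (Fact.out : p.Prime).ne_zero⟩; zmodSMulMu K (p ^ k) ζ (traceZMod S k (a * x))) :=
  rfl

/-- The `ℤ`-balance of `tracePairingAux` (needed to descend to the tensor product). [folklore] -/
theorem tracePairingAux_zsmul (k : ℕ) (r : ℤ) (a : padicCoeffIntegers S) (ζ : MuCarrier K (p ^ k)) :
    tracePairingAux S K k (r • a) ζ = tracePairingAux S K k a (r • ζ) := by
  haveI : NeZero (p ^ k) := ⟨pow_ne_zero _ (Fact.out : p.Prime).ne_zero⟩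
  ext x
  rw [tracePairingAux_apply, tracePairingAux_apply, smul_mul_assoc, map_zsmul]
  obtain ⟨w, hw⟩ := ZMod.intCast_surjective (traceZMod S k (a * x))
  rw [← hw, zsmul_eq_mul, ← Int.cast_mul, zmodSMulMu_intCast, zmodSMulMu_intCast, mul_comm, mul_zsmul]

/-- ★ **The trace pairing `(a ⊗ ζ, x) ↦ Tr_{𝒪/ℤ_p}(a x)·ζ : 𝒪 ⊗ μ_{p^k} → Hom(𝒪, μ_{p^k})`.** [cite: Rubin2000, §4.2] [cite: NeukirchSchmidtWingberg2008, (7.2.6)] -/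
def tracePairing (k : ℕ) : OMuCarrier K S (p ^ k) →+ (padicCoeffIntegers S →+ MuCarrier K (p ^ k)) :=
  (TensorProduct.liftAddHom (tracePairingAux S K k) (tracePairingAux_zsmul S K k)).comp OMuCarrier.toTensor.toAddMonoidHom

/-- ★ The trace pairing on pure tensors: `(a ⊗ ζ, x) ↦ Tr(a x)·ζ`. [cite: Rubin2000, §4.2] -/
theorem tracePairing_tmul (k : ℕ) (a : padicCoeffIntegers S) (ζ : MuCarrier K (p ^ k)) (x : padicCoeffIntegers S) :
    tracePairing S K k (OMuCarrier.tmul a ζ) x =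
      (haveI : NeZero (p ^ k) := ⟨pow_ne_zero _ (Fact.out : p.Prime).ne_zero⟩; zmodSMulMu K (p ^ k) ζ (traceZMod S k (a * x))) := by
  change (TensorProduct.liftAddHom (tracePairingAux S K k) (tracePairingAux_zsmul S K k)) (a ⊗ₜ ζ) x = _
  rw [TensorProduct.liftAddHom_tmul, tracePairingAux_apply]

/-- ★ **`𝒪`-balance**: `((c ⊗ id) w, x) = (w, c x)`. [cite: Rubin2000, §4.2] -/
theorem tracePairing_oMuScalar (k : ℕ) (c : padicCoeffIntegers S) (w : OMuCarrier K S (p ^ k)) (x : padicCoeffIntegers S) :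
    tracePairing S K k (oMuScalar S (p ^ k) c w) x = tracePairing S K k w (c * x) := by
  induction w using OMuCarrier.induction_on with
  | zero => simp only [map_zero, AddMonoidHom.zero_apply]
  | tmul a ζ => rw [oMuScalar_tmul, tracePairing_tmul, tracePairing_tmul, mul_assoc, mul_left_comm]
  | add y z hy hz => rw [map_add, map_add, AddMonoidHom.add_apply, hy, hz, map_add, AddMonoidHom.add_apply]

/-- ★ **`p^k 𝒪` lies in the right kernel**: `(w, p^k y) = 0` (so the pairing descends to `𝒪/p^k ≅ M[p^k]`). [cite: Rubin2000, §4.2] -/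
theorem tracePairing_natCast_pow_mul (k : ℕ) (w : OMuCarrier K S (p ^ k)) (y : padicCoeffIntegers S) :
    tracePairing S K k w (((p : ℕ) : padicCoeffIntegers S) ^ k * y) = 0 := by
  haveI : NeZero (p ^ k) := ⟨pow_ne_zero _ (Fact.out : p.Prime).ne_zero⟩
  induction w using OMuCarrier.induction_on with
  | zero => simp only [map_zero, AddMonoidHom.zero_apply]
  | tmul a ζ => rw [tracePairing_tmul, mul_left_comm, traceZMod_natCast_pow_mul, map_zero]
  | add y z hy hz => rw [map_add, AddMonoidHom.add_apply, hy, hz, add_zero]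

/-- `ι(ζ^p) = p·ζ` for `ζ ∈ μ_{p^{k+1}}`: the `p`-th power map `μ_{p^{k+1}} → μ_{p^k}` followed by the inclusion is multiplication by `p`. [folklore] -/
theorem muInclusion_muPowMap (k : ℕ) (ζ : MuCarrier K (p ^ (k + 1))) :
    (haveI : NeZero (p ^ k) := ⟨pow_ne_zero _ (Fact.out : p.Prime).ne_zero⟩
     haveI : NeZero (p ^ (k + 1)) := ⟨pow_ne_zero _ (Fact.out : p.Prime).ne_zero⟩
     muInclusion K (pow_dvd_pow p (Nat.le_succ k)) (muPowMap K (pow_dvd_pow p (Nat.le_succ k)) ζ)) = p • ζ := by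
  haveI : NeZero (p ^ k) := ⟨pow_ne_zero _ (Fact.out : p.Prime).ne_zero⟩
  haveI : NeZero (p ^ (k + 1)) := ⟨pow_ne_zero _ (Fact.out : p.Prime).ne_zero⟩
  apply muVal_injective K (p ^ (k + 1))
  have hdiv : p ^ (k + 1) / p ^ k = p := by rw [pow_succ, Nat.mul_div_cancel_left _ (Nat.pos_of_neZero _)]
  rw [muInclusion, AddMonoidHom.coe_mk, ZeroHom.coe_mk, muVal_muOfUnit, muVal_muPowMap, muVal_nsmul, hdiv]

/-- ★ **Level compatibility**: `ι((red w, y)_k) = (w, p y)_{k+1}` for `red = id ⊗ (ζ ↦ ζ^p)` (honda's `oMuRed`) and `ι : μ_{p^k} ⊆ μ_{p^{k+1}}` — under `M[p^k] ≅ 𝒪/p^k` the inclusion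
`M[p^k] ⊆ M[p^{k+1}]` is `y ↦ p y`. [cite: NeukirchSchmidtWingberg2008, (7.1.4), (7.2.6)] -/
theorem muInclusion_tracePairing_oMuRed (k : ℕ) (w : OMuCarrier K S (p ^ (k + 1))) (y : padicCoeffIntegers S) :
    (haveI : NeZero (p ^ k) := ⟨pow_ne_zero _ (Fact.out : p.Prime).ne_zero⟩
     haveI : NeZero (p ^ (k + 1)) := ⟨pow_ne_zero _ (Fact.out : p.Prime).ne_zero⟩
     muInclusion K (pow_dvd_pow p (Nat.le_succ k)) (tracePairing S K k (oMuRed S k w) y)) = tracePairing S K (k + 1) w (((p : ℕ) : padicCoeffIntegers S) * y) := by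
  haveI : NeZero (p ^ k) := ⟨pow_ne_zero _ (Fact.out : p.Prime).ne_zero⟩
  haveI : NeZero (p ^ (k + 1)) := ⟨pow_ne_zero _ (Fact.out : p.Prime).ne_zero⟩
  induction w using OMuCarrier.induction_on with
  | zero => simp only [map_zero, AddMonoidHom.zero_apply]
  | tmul a ζ =>
    rw [oMuRed_tmul, tracePairing_tmul, tracePairing_tmul, mul_left_comm,
      show ((p : ℕ) : padicCoeffIntegers S) = padicIntToCoeffIntegers S (p : ℤ_[p]) by rw [map_natCast], traceZMod_padicInt_mul, map_natCast]
    obtain ⟨z, hz⟩ := ZMod.intCast_surjective (traceZMod S (k + 1) (a * y))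
    have hk : traceZMod S k (a * y) = (z : ZMod (p ^ k)) := by
      rw [← traceZMod_succ_cast, ← hz, map_intCast]
    rw [hk, map_zmodSMulMu, muInclusion_muPowMap, ← hz, ← Int.cast_natCast, ← Int.cast_mul, zmodSMulMu_intCast, mul_comm, mul_zsmul, natCast_zsmul]
  | add u u' hu hu' => rw [map_add, map_add, AddMonoidHom.add_apply, map_add, hu, hu', map_add, AddMonoidHom.add_apply]

variable {K} in
/-- ★ **The twist law** (Galois equivariance in coordinates): for `σ ∈ Γ_K` and `t ∈ 𝒪` with `θ′(σ)·t = 1`, `((σ·w), t x) = σ·(w, x)` where `σ` acts on `𝒪 ⊗ μ ⊗ θ′` by honda's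
`muTwistO` (`a ⊗ ζ ↦ θ′(σ)a ⊗ σζ`) and on `μ_{p^k}` through `mu`; with `t = θ(σ)` and `θθ′ = 1` this is the equivariance against `(F/𝒪)(θ)[p^k] ≅ (𝒪/p^k)(θ)`.
[cite: Rubin2000, §4.2] [cite: JohnsonLeungKings2011, Def. 4.2] -/
theorem tracePairing_muTwistO [NumberField K] (θ' : absoluteGaloisGroup K →ₜ* (padicCoeffIntegers S)ˣ) (k : ℕ) (σ : absoluteGaloisGroup K) (t : padicCoeffIntegers S)
    (ht : ((θ' σ : (padicCoeffIntegers S)ˣ) : padicCoeffIntegers S) * t = 1) (w : OMuCarrier K S (p ^ k)) (x : padicCoeffIntegers S) :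
    (haveI : NeZero (p ^ k) := ⟨pow_ne_zero _ (Fact.out : p.Prime).ne_zero⟩
     tracePairing S K k (muTwistO S θ' k σ w) (t * x)) =
      (haveI : NeZero (p ^ k) := ⟨pow_ne_zero _ (Fact.out : p.Prime).ne_zero⟩; mu K (p ^ k) σ (tracePairing S K k w x)) := by
  haveI : NeZero (p ^ k) := ⟨pow_ne_zero _ (Fact.out : p.Prime).ne_zero⟩
  induction w using OMuCarrier.induction_on with
  | zero => simp only [map_zero, AddMonoidHom.zero_apply]
  | tmul a ζ =>
    rw [muTwistO_tmul, tracePairing_tmul, tracePairing_tmul, show (θ' σ : padicCoeffIntegers S) * a * (t * x) = a * x by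
      rw [mul_comm _ a, mul_assoc, ← mul_assoc _ t, ht, one_mul]]
    obtain ⟨z, hz⟩ := ZMod.intCast_surjective (traceZMod S k (a * x))
    rw [← hz, zmodSMulMu_intCast, zmodSMulMu_intCast, map_zsmul]
  | add u u' hu hu' => rw [map_add, map_add, AddMonoidHom.add_apply, hu, hu', map_add, AddMonoidHom.add_apply, map_add]

end Pairing

end Summit.BirchSwinnertonDyer.BirchSwinnertonDyer.Theorems.SmallImageRttD2Seq

end
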